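import Mathlib
import Summits.Ventures.PercRepro2.M9LatticeHarris

/-!
# The quad inequality — the combinatorial heart of THEOREM RK-NP (blind cell PercRepro2,
p3 g35, 2026-08-29; `proofs/P3-NPHDR.md` §5(f))

On the hypercube of the joined blocks `ι`: `ℓ S` is the link indicator of the `Y`-side set `S`
(monotone, `0 ≤ ℓ ≤ 1`, `ℓ ∅ = 0`), `HY S` and `HW S` the `p ~_Y q` counts of the extreme
co-fibres of a quad with the joined `W`-side set `S` (`HW` monotone, `HY ≤ HW`).  The reached sum of
a quad is bounded by `2·Σ_{∅ ≠ S ≠ univ} (1 − ℓ S)·(HY S − HW Sᶜ)` (the doubly-reached points,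
an exact identity) plus `N₁·(HY ∅ − HW univ)` (the one-sided `K`-points, `N₁` the number of
dead patterns carrying a `Y`-link, at least the number of linking non-empty `Y`-side sets).
**The quad inequality** (`quad_sum_nonpos`): this bound is `≤ 0` — by `HY ≤ HW`, the
antisymmetry `S ↔ Sᶜ`, termwise monotonicity, and Harris on the hypercube
(`sum_sub_compl_mul_nonpos_of_sublattice` of `M9LatticeHarris` with `L = univ`, `G = HW`,
`H = −ℓ`).  Own work; std axioms.
-/

namespace Summit.Ventures.PercRepro2

namespace M9Reduce

open Finset

variable {ι : Type*} [Fintype ι] [DecidableEq ι]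

/-- The proper non-empty subsets. -/
def proper : Finset (Finset ι) := univ.filter (fun S => S ≠ ∅ ∧ S ≠ univ)

/-- Membership in the proper non-empty subsets. -/
lemma mem_proper {S : Finset ι} : S ∈ (proper : Finset (Finset ι)) ↔ S ≠ ∅ ∧ S ≠ univ := by
  simp [proper]

/-- The complement of a proper non-empty subset is proper and non-empty. -/
lemma compl_mem_proper {S : Finset ι} (h : S ∈ (proper : Finset (Finset ι))) :
    Sᶜ ∈ (proper : Finset (Finset ι)) := by
  rw [mem_proper] at h ⊢
  exact ⟨fun h' => h.2 ((compl_eq_empty_iff _).1 h'), fun h' => h.1 ((compl_eq_univ_iff _).1 h')⟩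

/-- An antisymmetric function sums to zero over the proper subsets. -/
lemma sum_proper_sub_compl (F : Finset ι → ℤ) :
    ∑ S ∈ (proper : Finset (Finset ι)), (F S - F Sᶜ) = 0 := by
  rw [Finset.sum_sub_distrib]
  have : ∑ S ∈ (proper : Finset (Finset ι)), F Sᶜ = ∑ S ∈ (proper : Finset (Finset ι)), F S := by
    refine Finset.sum_nbij' (fun S => Sᶜ) (fun S => Sᶜ) (fun S hS => compl_mem_proper hS)
      (fun S hS => compl_mem_proper hS) (fun S _ => compl_compl S) (fun S _ => compl_compl S)
      (fun S _ => rfl)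
  rw [this, sub_self]

/-- Harris on the full hypercube, in the form used here: for `ℓ`, `HW` monotone,
`Σ_S ℓ S · (HW Sᶜ − HW S) ≤ 0`. -/
lemma sum_link_mul_sub_nonpos {ℓ HW : Finset ι → ℤ} (hℓ : Monotone ℓ) (hW : Monotone HW) :
    ∑ S : Finset ι, ℓ S * (HW Sᶜ - HW S) ≤ 0 := by
  have h := sum_sub_compl_mul_nonpos_of_sublattice (L := (univ : Finset (Finset ι)))
    (fun _ _ _ _ => Finset.mem_univ _) (fun _ _ _ _ => Finset.mem_univ _)
    (fun _ _ => Finset.mem_univ _) (G := HW) (H := fun S => -ℓ S) hW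
    (fun S T hST => by simp only [neg_le_neg_iff]; exact hℓ hST)
  have : ∑ S : Finset ι, ℓ S * (HW Sᶜ - HW S) = ∑ S ∈ (univ : Finset (Finset ι)),
      (HW S - HW Sᶜ) * (fun S => -ℓ S) S := by
    refine Finset.sum_congr rfl (fun S _ => ?_)
    ring
  rw [this]
  exact h

/-- **The quad inequality.** -/
theorem quad_sum_nonpos [Nonempty ι] {ℓ HY HW : Finset ι → ℤ} (hℓ : Monotone ℓ) (hℓ0 : ∀ S, 0 ≤ ℓ S)
    (hℓ1 : ∀ S, ℓ S ≤ 1) (hℓe : ℓ ∅ = 0) (hW : Monotone HW)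
    (hYW : ∀ S, HY S ≤ HW S) {N₁ : ℤ}
    (hN₁ : ∑ S ∈ (univ : Finset (Finset ι)).filter (fun S => S ≠ ∅), ℓ S ≤ N₁) :
    2 * (∑ S ∈ (proper : Finset (Finset ι)), (1 - ℓ S) * (HY S - HW Sᶜ)) +
      N₁ * (HY ∅ - HW univ) ≤ 0 := by
  -- Step 1: `HY ≤ HW` in the doubly-reached part
  have h1 : ∑ S ∈ (proper : Finset (Finset ι)), (1 - ℓ S) * (HY S - HW Sᶜ) ≤
      ∑ S ∈ (proper : Finset (Finset ι)), (1 - ℓ S) * (HW S - HW Sᶜ) := by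
    refine Finset.sum_le_sum (fun S _ => ?_)
    have := hℓ1 S
    have := hYW S
    nlinarith
  -- Step 2: antisymmetry turns `(1 − ℓ)` into `−ℓ`
  have h2 : ∑ S ∈ (proper : Finset (Finset ι)), (1 - ℓ S) * (HW S - HW Sᶜ) =
      ∑ S ∈ (proper : Finset (Finset ι)), ℓ S * (HW Sᶜ - HW S) := by
    have hz := sum_proper_sub_compl (ι := ι) HW
    have : ∑ S ∈ (proper : Finset (Finset ι)), (1 - ℓ S) * (HW S - HW Sᶜ) =
        ∑ S ∈ (proper : Finset (Finset ι)), (HW S - HW Sᶜ) +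
          ∑ S ∈ (proper : Finset (Finset ι)), ℓ S * (HW Sᶜ - HW S) := by
      rw [← Finset.sum_add_distrib]
      refine Finset.sum_congr rfl (fun S _ => ?_)
      ring
    rw [this, hz, zero_add]
  -- Step 3: the one-sided part, `HY ∅ ≤ HW ∅` and `N₁` at least the number of linking sets
  have hneg : HY ∅ - HW univ ≤ 0 := by
    have := hYW ∅
    have := hW (Finset.empty_subset (univ : Finset ι))
    linarith
  have h3 : N₁ * (HY ∅ - HW univ) ≤
      (∑ S ∈ (univ : Finset (Finset ι)).filter (fun S => S ≠ ∅), ℓ S) * (HW ∅ - HW univ) := by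
    have hsum0 : 0 ≤ ∑ S ∈ (univ : Finset (Finset ι)).filter (fun S => S ≠ ∅), ℓ S :=
      Finset.sum_nonneg (fun S _ => hℓ0 S)
    have hYW0 := hYW ∅
    nlinarith [mul_le_mul_of_nonpos_right hN₁ hneg]
  -- Step 4: the termwise bound on the proper subsets, and the two corners
  have hsplit : ∑ S ∈ (univ : Finset (Finset ι)).filter (fun S => S ≠ ∅), ℓ S =
      ∑ S ∈ (proper : Finset (Finset ι)), ℓ S + ℓ univ := by
    have hne : (univ : Finset ι) ∈ (univ : Finset (Finset ι)).filter (fun S => S ≠ ∅) := by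
      simp only [Finset.mem_filter, Finset.mem_univ, true_and]
      exact Finset.univ_nonempty.ne_empty
    rw [← Finset.sum_erase_add _ _ hne]
    congr 1
    refine Finset.sum_congr ?_ (fun _ _ => rfl)
    ext S
    simp only [Finset.mem_erase, Finset.mem_filter, Finset.mem_univ, true_and, mem_proper]
    tauto
  have h4 : ∑ S ∈ (proper : Finset (Finset ι)),
      (2 * (ℓ S * (HW Sᶜ - HW S)) + ℓ S * (HW ∅ - HW univ)) ≤
      ∑ S ∈ (proper : Finset (Finset ι)), ℓ S * (HW Sᶜ - HW S) := by
    refine Finset.sum_le_sum (fun S _ => ?_)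
    have ha := hW (Finset.empty_subset S)
    have hb := hW (Finset.subset_univ Sᶜ)
    have := hℓ0 S
    nlinarith
  have hall : ∑ S : Finset ι, ℓ S * (HW Sᶜ - HW S) =
      ∑ S ∈ (proper : Finset (Finset ι)), ℓ S * (HW Sᶜ - HW S) + ℓ univ * (HW ∅ - HW univ) := by
    have hu : (univ : Finset ι) ∉ (proper : Finset (Finset ι)) := by
      rw [mem_proper]; tauto
    have he : (∅ : Finset ι) ∉ insert (univ : Finset ι) (proper : Finset (Finset ι)) := by
      simp only [Finset.mem_insert, mem_proper, not_or]
      exact ⟨Finset.univ_nonempty.ne_empty.symm, fun h => h.1 rfl⟩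
    have hcover : (univ : Finset (Finset ι)) =
        insert (∅ : Finset ι) (insert (univ : Finset ι) (proper : Finset (Finset ι))) := by
      ext S
      simp only [Finset.mem_univ, Finset.mem_insert, mem_proper, true_iff]
      tauto
    rw [hcover, Finset.sum_insert he, Finset.sum_insert hu, hℓe]
    simp only [zero_mul, zero_add, Finset.compl_univ]
    ring
  have hH := sum_link_mul_sub_nonpos hℓ hW
  rw [hall] at hH
  -- assemble
  have hsum4 : ∑ S ∈ (proper : Finset (Finset ι)),
      (2 * (ℓ S * (HW Sᶜ - HW S)) + ℓ S * (HW ∅ - HW univ)) =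
      2 * ∑ S ∈ (proper : Finset (Finset ι)), ℓ S * (HW Sᶜ - HW S) +
        (∑ S ∈ (proper : Finset (Finset ι)), ℓ S) * (HW ∅ - HW univ) := by
    rw [Finset.sum_add_distrib, ← Finset.mul_sum, Finset.sum_mul]
  rw [hsplit] at h3
  nlinarith [h1, h2, h3, h4, hH, hsum4]

end M9Reduce

end Summit.Ventures.PercRepro2
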